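import Summits.Ventures.HodgeRepro2.TiltHeckeMultiCoset
import Summits.Ventures.HodgeRepro2.HeckeCommuteNormalizer
import Summits.Ventures.HodgeRepro2.DefiniteAnisotropic
import Summits.Ventures.HodgeRepro2.HeckeLinear

/-!
# AntidiagonalQuasiSplit — the antidiagonal model `antidiag(1, u, 1)` is the QUASI-SPLIT `U(2,1)` (isotropic,
never definite, hence NOT the record's compact Picard datum), and on it the Atkin–Lehner involution
`w = diag(−1,1,−1)` commutes with the multi-coset tilt involution `δ₄`: ball-level Hecke commutation and
Atkin–Lehner splitting of the `T_{δ₄}`-eigenforms on `Γ_N` (p2 annex row 163)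

Cell pub-hodge-repro2, Tier 5 kernel annex (seat p2, Shimura-data / Hecke side). Proof lane (no new definition).
§8(d): uses an L-value-free non-vanishing device: NO.

HONESTY (A). `e₀* H_u e₀ = 0`: the antidiagonal form is ISOTROPIC (`not_isAnisotropic_antidiagForm`), hence by row
152 it is definite at NO complex place (`not_isDefiniteAt_antidiagForm`) and, for `[K : ℚ] > 2`, it is NOT a
Picard signature in the sense of the record (`not_isPicardSignature_antidiagForm_of_two_lt_finrank`): the rows
about `U(antidiag(1,u,1))` (154 / 155 / 161 / this file) are facts about the quasi-split model whose arithmetic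
quotients `Γ_N\𝔹²` are non-compact (Godement; prose). They are stated at the GROUP level and at the level of
FUNCTIONS ON THE BALL — never through the compact-quotient Petersson space of rows 126–149, which this form
does not instantiate.

(B) `w = signInvolutionGL` normalises every `Γ_N` of a coordinate lattice (`signInvolutionGL_normalizes_shimuraLevel`,
rows 153–154) and commutes with `δ₄ = tiltInvolutionFour` (`signInvolutionGL_conj_tiltInvolutionFour`: `w δ₄ w⁻¹ = δ₄`).

(C) With row 166's linearity of `T_δ` on functions (`hecke_add`, `hecke_sub`, `hecke_smul`, `hecke_congr`):
`T_{δ₄} (T_w f) = T_w (T_{δ₄} f)` on the ball for every weight-`k` form `f` for `Γ_N` (`hecke_sign_tilt_comm`, from row 159); and the ATKIN–LEHNER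
SPLITTING at the function level (`hecke_signInvolution_split`): with `f₊ = f + T_w f`, `f₋ = f − T_w f`
(`T_w f = f∥w`, `T_w T_w = id` by row 154), `T_w f± = ±f±`, `f = ½ (f₊ + f₋)`, and if `T_{δ₄} f = μ f` on the ball
then `T_{δ₄} f± = μ f±` on the ball.

No `sorry`; `#print axioms` ⊆ {propext, Classical.choice, Quot.sound}.
-/

namespace Summit.Ventures.HodgeRepro2.ShimuraData

open Matrix

variable {K : Type*} [Field K]

section Isotropic

variable [NumberField K] [NumberField.IsCMField K]

/-- `e₀* H_u e₀ = H_u 0 0 = 0`. -/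
theorem hermDot_antidiagForm_single_zero (u : K) :
    hermDot (antidiagForm u) (Pi.single 0 1) (Pi.single 0 1) = 0 := by
  rw [hermDot_single_single]
  simp [antidiagForm]

/-- The antidiagonal form is ISOTROPIC: `e₀` is a non-zero isotropic vector. -/
theorem not_isAnisotropic_antidiagForm (u : K) : ¬ IsAnisotropic (antidiagForm u) := by
  intro h
  have := h (Pi.single 0 1) (hermDot_antidiagForm_single_zero u)
  have h0 : (Pi.single 0 1 : Fin 3 → K) 0 = 0 := by rw [this]; rfl
  simp at h0

/-- The antidiagonal form is definite at NO complex place (row 152: definite ⇒ anisotropic). -/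
theorem not_isDefiniteAt_antidiagForm {u : K} (hu : ρ K u = u) (τ : K →+* ℂ) :
    ¬ IsDefiniteAt K τ (antidiagForm u) := fun h =>
  not_isAnisotropic_antidiagForm u (isAnisotropic_of_isDefiniteAt (isHermitianForm_antidiagForm hu) h)

/-- For `[K : ℚ] > 2` the antidiagonal model is NOT a Picard signature of the record (it is the quasi-split
`U(2,1)`, indefinite at every place; the record's datum is definite at every place other than `τ₁`). -/
theorem not_isPicardSignature_antidiagForm_of_two_lt_finrank {u : K} (hu : ρ K u = u)
    (hK : 2 < Module.finrank ℚ K) (τ₁ : K →+* ℂ) : ¬ IsPicardSignature K τ₁ (antidiagForm u) := by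
  intro h
  obtain ⟨τ, hτ⟩ := exists_infinitePlace_ne_of_two_lt_finrank hK τ₁
  exact not_isDefiniteAt_antidiagForm hu τ (h.2 τ hτ)

end Isotropic

/-- `w · r_t = r_t · w` for the sign involution `w = diag(−1,1,−1)` and the tilt matrix `r_t`. -/
theorem signInvolution_mul_tiltReflection (t : K) :
    (signInvolution : Matrix (Fin 3) (Fin 3) K) * tiltReflection t = tiltReflection t * signInvolution := by
  ext i j
  fin_cases i <;> fin_cases j <;>
    simp [signInvolution, tiltReflection, Matrix.mul_apply, Matrix.diagonal]

/-- `w δ_t = δ_t w` in `GL₃(K)` for `δ_t = −tiltReflectionGL t`. -/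
theorem signInvolutionGL_mul_neg_tiltReflectionGL_comm (t : K) (ht0 : t ≠ 0) :
    (signInvolutionGL : GL (Fin 3) K) * -tiltReflectionGL t ht0 = -tiltReflectionGL t ht0 * signInvolutionGL := by
  apply Units.ext
  simp only [Units.val_mul, Units.val_neg, coe_signInvolutionGL, coe_tiltReflectionGL, mul_neg, neg_mul,
    signInvolution_mul_tiltReflection]

variable [NumberField K]

/-- `w δ₄ = δ₄ w`. -/
theorem signInvolutionGL_mul_tiltInvolutionFour_comm :
    (signInvolutionGL : GL (Fin 3) K) * tiltInvolutionFour = tiltInvolutionFour * signInvolutionGL :=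
  signInvolutionGL_mul_neg_tiltReflectionGL_comm 4 four_ne_zero'

/-- `w δ₄ w⁻¹ = δ₄`. -/
theorem signInvolutionGL_conj_tiltInvolutionFour :
    (signInvolutionGL : GL (Fin 3) K) * tiltInvolutionFour * signInvolutionGL⁻¹ = tiltInvolutionFour := by
  rw [signInvolutionGL_mul_tiltInvolutionFour_comm, mul_inv_cancel_right]

variable [NumberField.IsCMField K]

/-- The sign involution normalises `Γ_N` for the standard lattice (rows 153–154). -/
theorem signInvolutionGL_normalizes_shimuraLevel {u : K} (hu : ρ K u = u) (hu0 : u ≠ 0) (N : ℕ)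
    (s : GL (Fin 3) K) :
    s ∈ shimuraLevelSubgroup K (antidiagForm u) (standardLattice K 3) N ↔
      (signInvolutionGL : GL (Fin 3) K) * s * signInvolutionGL⁻¹ ∈
        shimuraLevelSubgroup K (antidiagForm u) (standardLattice K 3) N :=
  mem_shimuraLevel_conj_iff ((Subgroup.mem_inf.mp (signInvolutionGL_mem_specialUnitaryGroup hu hu0)).1)
    (stabilizesLattice_signInvolutionGL standardLattice_coordinate) s

section Ball

variable {τ₁ : K →+* ℂ} {u : K} {Q : Matrix (Fin 3) (Fin 3) ℂ} (hQ : IsFrame K τ₁ (antidiagForm u) Q)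
  (hu : ρ K u = u) (hu0 : u ≠ 0) (N : ℕ)
  [Fintype (shimuraLevelSubgroup K (antidiagForm u) (standardLattice K 3) N ⧸
    (heckeSubgroup (shimuraLevelSubgroup K (antidiagForm u) (standardLattice K 3) N) signInvolutionGL).subgroupOf
      (shimuraLevelSubgroup K (antidiagForm u) (standardLattice K 3) N))]
  [Fintype (shimuraLevelSubgroup K (antidiagForm u) (standardLattice K 3) N ⧸
    (heckeSubgroup (shimuraLevelSubgroup K (antidiagForm u) (standardLattice K 3) N) tiltInvolutionFour).subgroupOf
      (shimuraLevelSubgroup K (antidiagForm u) (standardLattice K 3) N))]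
  [Fintype (shimuraLevelSubgroup K (antidiagForm u) (standardLattice K 3) N ⧸
    (heckeSubgroup (shimuraLevelSubgroup K (antidiagForm u) (standardLattice K 3) N)
      (signInvolutionGL * tiltInvolutionFour)).subgroupOf
      (shimuraLevelSubgroup K (antidiagForm u) (standardLattice K 3) N))]
  [Fintype (shimuraLevelSubgroup K (antidiagForm u) (standardLattice K 3) N ⧸
    (heckeSubgroup (shimuraLevelSubgroup K (antidiagForm u) (standardLattice K 3) N)
      (tiltInvolutionFour * signInvolutionGL)).subgroupOf
      (shimuraLevelSubgroup K (antidiagForm u) (standardLattice K 3) N))]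
  {k : ℕ} {f : (Fin 2 → ℂ) → ℂ}
  (hf : IsWeightFor τ₁ Q (shimuraLevelSubgroup K (antidiagForm u) (standardLattice K 3) N) k f)

include hQ hu hu0 hf in
/-- `T_{δ₄} (T_w f) = T_w (T_{δ₄} f)` on the ball for every weight-`k` form `f` for `Γ_N` (row 159's
`hecke_comm_of_normalizes_of_doubleCoset_eq` with `w δ₄ w⁻¹ = δ₄`). -/
theorem hecke_sign_tilt_comm {z : Fin 2 → ℂ} (hz : z ∈ ball₂) :
    hecke (shimuraLevelSubgroup K (antidiagForm u) (standardLattice K 3) N) tiltInvolutionFour τ₁ Q k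
        (hecke (shimuraLevelSubgroup K (antidiagForm u) (standardLattice K 3) N) signInvolutionGL τ₁ Q k f) z =
      hecke (shimuraLevelSubgroup K (antidiagForm u) (standardLattice K 3) N) signInvolutionGL τ₁ Q k
        (hecke (shimuraLevelSubgroup K (antidiagForm u) (standardLattice K 3) N) tiltInvolutionFour τ₁ Q k f) z :=
  hecke_comm_of_normalizes_of_doubleCoset_eq hQ (shimuraLevelSubgroup_subset_unitaryGroup _ _ _)
    (signInvolutionGL_normalizes_shimuraLevel hu hu0 N)
    ((Subgroup.mem_inf.mp (signInvolutionGL_mem_specialUnitaryGroup hu hu0)).1)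
    ((Subgroup.mem_inf.mp (tiltInvolutionFour_mem_specialUnitaryGroup hu)).1)
    (doubleCoset_mul_eq_of_conj_mem (signInvolutionGL_normalizes_shimuraLevel hu hu0 N)
      (by rw [signInvolutionGL_conj_tiltInvolutionFour]; exact mem_doubleCoset_self _ _)) hf hz

include hQ hu hu0 hf in
/-- ATKIN–LEHNER SPLITTING ON THE BALL. With `g = T_w f` (`= f∥w`): `T_w (f + g) = f + g`, `T_w (f − g) = −(f − g)`,
`f = ½ ((f + g) + (f − g))` on the ball, and if `T_{δ₄} f = μ f` on the ball then `T_{δ₄} (f ± g) = μ (f ± g)`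
on the ball. -/
theorem hecke_signInvolution_split {z : Fin 2 → ℂ} (hz : z ∈ ball₂) :
    let S := shimuraLevelSubgroup K (antidiagForm u) (standardLattice K 3) N
    let g := hecke S signInvolutionGL τ₁ Q k f
    hecke S signInvolutionGL τ₁ Q k (f + g) z = (f + g) z ∧
    hecke S signInvolutionGL τ₁ Q k (f - g) z = -((f - g) z) ∧
    f z = (2 : ℂ)⁻¹ * ((f + g) z + (f - g) z) ∧
    (∀ μ : ℂ, (∀ z' ∈ ball₂, hecke S tiltInvolutionFour τ₁ Q k f z' = μ * f z') →
      hecke S tiltInvolutionFour τ₁ Q k (f + g) z = μ * (f + g) z ∧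
      hecke S tiltInvolutionFour τ₁ Q k (f - g) z = μ * (f - g) z) := by
  intro S g
  have hww : hecke S signInvolutionGL τ₁ Q k g z = f z :=
    (hecke_signInvolution_antidiagForm hu hu0 hQ standardLattice_coordinate hf hz).2
  refine ⟨?_, ?_, ?_, ?_⟩
  · rw [hecke_add, Pi.add_apply, hww, Pi.add_apply, add_comm]
  · rw [hecke_sub, Pi.sub_apply, hww, Pi.sub_apply, neg_sub]
  · simp only [Pi.add_apply, Pi.sub_apply]; ring
  · intro μ hμ
    have hcomm : hecke S tiltInvolutionFour τ₁ Q k g z = μ * g z := by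
      rw [hecke_sign_tilt_comm hQ hu hu0 N hf hz,
        hecke_congr hQ (shimuraLevelSubgroup_subset_unitaryGroup _ _ _)
          ((Subgroup.mem_inf.mp (signInvolutionGL_mem_specialUnitaryGroup hu hu0)).1)
          (g := μ • f) (fun w hw => by rw [hμ w hw]; rfl) hz,
        hecke_smul, Pi.smul_apply, smul_eq_mul]
    constructor
    · rw [hecke_add, Pi.add_apply, hμ z hz, hcomm, Pi.add_apply]; ring
    · rw [hecke_sub, Pi.sub_apply, hμ z hz, hcomm, Pi.sub_apply]; ring

end Ball

end Summit.Ventures.HodgeRepro2.ShimuraData
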